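/-
# Theta bodies of unbounded curves: the cusp and the strophoid
# (Blekherman–Parrilo–Thomas, Ch. 7 §7.3.1, Examples 7.31 and 7.33)

[cite: BlekhermanParriloThomas2012, Ch. 7 (Gouveia–Thomas, *Convex hulls of algebraic sets*)
§7.3.1, Example 7.31 p. 320 (the cusp `x² = y³`: `TH_k(I) = ℝ²` for every `k`) and Example 7.33
p. 321 (the strophoid: `1 ± y` are `2`-sos modulo the ideal, so `TH_2(I)` lies in the band
`-1 ≤ y ≤ 1`)]

* **Example 7.31.**  For `I = ⟨x² - y³⟩` no affine polynomial other than a nonnegative constant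
  is a sum of squares modulo `I` (`eq_zero_of_isSosMod_cusp`); hence `TH_k(I) = ℝ²` for every
  `k` (`thetaBody_cusp_eq_univ`) although `cl(conv(V_ℝ(I)))` lies in the upper half-plane, so
  `I` is not `TH_k`-exact for any `k` (`not_isThetaExact_cusp`): "the theta bodies are
  completely ineffective in approximating `conv(V_ℝ(I))`".  The book argues with the standard
  form `a(y) + x·b(y)` modulo `I` and the remark that "the highest degree terms cannot all
  cancel" in a sum of squares; we run the same degree count after applying the parametrisation
  `x ↦ t³, y ↦ t²` of the cusp (an algebra map `ℝ[x,y] → ℝ[t]` killing `I` whose image has no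
  `t¹`-term): `α + a₂t² + a₁t³ = ∑ g_j²` forces `deg g_j ≤ 1`
  (`natDegree_le_of_natDegree_sum_sq_le`, the formal version of "the highest degree terms
  cannot all cancel"), hence every `g_j` is a constant and `a₁ = a₂ = 0 ≤ α`.
* **Example 7.33.**  For the strophoid `p = (1 - y)x² - (1 + y)y²` the printed identities
  `1 ± y = (1 ± y/2 - y²/2)² + ¼(∓y - y²)² + ½(xy - x)² + ½(y - 1)·p`
  (`four_mul_one_add_X_one`, `four_mul_one_sub_X_one`, cleared of denominators) show that
  `1 ± y` are `2`-sos modulo `⟨p⟩`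
  (`isKSosMod_two_one_add`, `isKSosMod_two_one_sub`), so `TH_2(⟨p⟩) ⊆ B := {-1 ≤ y ≤ 1}`
  (`thetaBody_two_strophoid_subset_band`).

Not formalised: the reverse inclusion `B ⊆ TH_2(⟨p⟩)` of Example 7.33 (i.e. that the closure
of the convex hull of the strophoid is the whole band), the closing remark of Example 7.31 on
curves `x² - p(y)` with `p` of odd degree, and Theorem 7.32 (compact varieties).
-/
import Mathlib
import Literature.Algebra.Polynomial.ThetaBodies
import HarnessLib

open MvPolynomial
open scoped BigOperators

namespace Literature.Algebra.Polynomial.ThetaBodiesCusp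

open Literature.Algebra.Polynomial.ThetaBodies

noncomputable section

/-! ## "The highest degree terms cannot all cancel": a degree count for sums of squares -/

/-- In `ℝ[t]`, if `∑_j g_j²` has degree at most `2D + 1` then every `g_j` has degree at most
`D` (the top coefficients of the squares of the `g_j` of maximal degree are positive and cannot
cancel). [cite: BlekhermanParriloThomas2012, Ch. 7 §7.3.1, Example 7.31, p. 320 ("the highest
degree terms cannot all cancel")] -/
theorem natDegree_le_of_natDegree_sum_sq_le {m D : ℕ} (g : Fin m → Polynomial ℝ)
    (h : (∑ j, g j ^ 2).natDegree ≤ 2 * D + 1) (j : Fin m) : (g j).natDegree ≤ D := by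
  by_contra hj
  rw [not_le] at hj
  set N := Finset.univ.sup fun l => (g l).natDegree with hN
  have hjN : (g j).natDegree ≤ N := Finset.le_sup (f := fun l => (g l).natDegree)
    (Finset.mem_univ j)
  -- the coefficient of `t^{2N}` in `∑ g_l²` is `∑ (coeff_N g_l)²`
  have hcoeff : (∑ l, g l ^ 2).coeff (2 * N) = ∑ l, (g l).coeff N ^ 2 := by
    rw [Polynomial.finsetSum_coeff]
    refine Finset.sum_congr rfl fun l _ => ?_
    exact Polynomial.coeff_pow_of_natDegree_le
      (Finset.le_sup (f := fun l => (g l).natDegree) (Finset.mem_univ l))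
  -- … and vanishes since `2N > 2D + 1 ≥ deg ∑ g_l²`
  have hzero : (∑ l, g l ^ 2).coeff (2 * N) = 0 :=
    Polynomial.coeff_eq_zero_of_natDegree_lt (by omega)
  -- but some `g_l` has degree exactly `N ≥ 1`, so its `N`-th coefficient is nonzero
  obtain ⟨l, -, hl⟩ :=
    Finset.exists_mem_eq_sup Finset.univ ⟨j, Finset.mem_univ j⟩ fun l => (g l).natDegree
  have hgl : g l ≠ 0 := fun h0 => by
    rw [h0, Polynomial.natDegree_zero] at hl; omega
  have hlN : N = (g l).natDegree := by rw [hN]; exact hl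
  have hlc : (g l).coeff N ≠ 0 := by
    rw [hlN, Polynomial.coeff_natDegree]; exact Polynomial.leadingCoeff_ne_zero.2 hgl
  have hpos : 0 < ∑ l, (g l).coeff N ^ 2 :=
    lt_of_lt_of_le (lt_of_le_of_ne (sq_nonneg _) (Ne.symm (pow_ne_zero 2 hlc)))
      (Finset.single_le_sum (fun i _ => sq_nonneg ((g i).coeff N)) (Finset.mem_univ l))
  rw [← hcoeff, hzero] at hpos
  exact lt_irrefl _ hpos

/-- A polynomial of degree `≤ 1` without `t¹`-term is a constant. [folklore] -/
private theorem eq_C_of_natDegree_le_one {g : Polynomial ℝ} (h1 : g.natDegree ≤ 1)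
    (h0 : g.coeff 1 = 0) : g = Polynomial.C (g.coeff 0) := by
  ext n
  rcases n with _ | _ | n
  · simp
  · simp [h0]
  · rw [Polynomial.coeff_C, if_neg (by omega)]
    exact Polynomial.coeff_eq_zero_of_natDegree_lt (by omega)

/-! ## Example 7.31: the cusp `x² = y³` -/

/-- The cusp curve `x² - y³` (variables `x = X 0`, `y = X 1`).
[cite: BlekhermanParriloThomas2012, Ch. 7 §7.3.1, Example 7.31, p. 320] -/
def cuspCurve : MvPolynomial (Fin 2) ℝ := X 0 ^ 2 - X 1 ^ 3

/-- The parametrisation `t ↦ (t³, t²)` of the cusp, as the algebra map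
`ψ : ℝ[x,y] → ℝ[t]`, `x ↦ t³`, `y ↦ t²`. [folklore] -/
private def cuspCurveParam : MvPolynomial (Fin 2) ℝ →ₐ[ℝ] Polynomial ℝ :=
  aeval ![Polynomial.X ^ 3, Polynomial.X ^ 2]

/-- `ψ(x) = t³`. [folklore] -/
@[simp] private theorem cuspCurveParam_X_zero :
    cuspCurveParam (X 0) = Polynomial.X ^ 3 := by
  simp [cuspCurveParam]

/-- `ψ(y) = t²`. [folklore] -/
@[simp] private theorem cuspCurveParam_X_one :
    cuspCurveParam (X 1) = Polynomial.X ^ 2 := by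
  simp [cuspCurveParam]

/-- `ψ` on scalars. [folklore] -/
@[simp] private theorem cuspCurveParam_C (r : ℝ) :
    cuspCurveParam (C r) = Polynomial.C r := by
  simp [cuspCurveParam, Polynomial.algebraMap_eq]

/-- `ψ(x² - y³) = t⁶ - t⁶ = 0`: the parametrisation lands on the cusp. [folklore] -/
private theorem cuspCurveParam_cusp : cuspCurveParam cuspCurve = 0 := by
  simp only [cuspCurve, map_sub, map_pow, cuspCurveParam_X_zero, cuspCurveParam_X_one]
  ring

/-- Hence `ψ` vanishes on the ideal `I = ⟨x² - y³⟩`. [folklore] -/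
private theorem cuspCurveParam_eq_zero_of_mem {g : MvPolynomial (Fin 2) ℝ}
    (hg : g ∈ Ideal.span {cuspCurve}) :
    cuspCurveParam g = 0 := by
  obtain ⟨q, rfl⟩ := Ideal.mem_span_singleton'.1 hg
  rw [map_mul, cuspCurveParam_cusp, mul_zero]

/-- The image of `ψ` has no `t¹`-term: `ψ(h)` is a combination of the monomials `t^{3i+2j}`.
[folklore] -/
private theorem coeff_one_cuspCurveParam (h : MvPolynomial (Fin 2) ℝ) :
    (cuspCurveParam h).coeff 1 = 0 := by
  induction h using MvPolynomial.induction_on with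
  | C a => rw [cuspCurveParam_C, Polynomial.coeff_C, if_neg one_ne_zero]
  | add p q hp hq => rw [map_add, Polynomial.coeff_add, hp, hq, add_zero]
  | mul_X p i hp =>
    obtain ⟨n, hn2, hn⟩ : ∃ n, 2 ≤ n ∧ cuspCurveParam (X i) = Polynomial.X ^ n := by
      fin_cases i
      · exact ⟨3, by norm_num, cuspCurveParam_X_zero⟩
      · exact ⟨2, le_rfl, cuspCurveParam_X_one⟩
    rw [map_mul, hn, Polynomial.coeff_mul_X_pow', if_neg (by omega)]

/-- `ψ(α + a₀x + a₁y) = α + a₁t² + a₀t³`. [folklore] -/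
private theorem cuspCurveParam_affinePoly (α : ℝ) (a : Fin 2 → ℝ) :
    cuspCurveParam (affinePoly α a) =
      Polynomial.C α + Polynomial.C (a 1) * Polynomial.X ^ 2 +
        Polynomial.C (a 0) * Polynomial.X ^ 3 := by
  simp only [affinePoly, map_add, map_mul, cuspCurveParam_C, cuspCurveParam_X_zero,
    cuspCurveParam_X_one, Fin.sum_univ_two]
  ring

/-- **Example 7.31** (the algebraic heart): if an affine polynomial `l = α + a₀x + a₁y` is a
sum of squares modulo `I = ⟨x² - y³⟩`, then `a₀ = a₁ = 0` and `α ≥ 0` — "`y + ε` is a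
constant, which is clearly a contradiction".
[cite: BlekhermanParriloThomas2012, Ch. 7 §7.3.1, Example 7.31, p. 320] -/
theorem eq_zero_of_isSosMod_cusp {α : ℝ} {a : Fin 2 → ℝ}
    (hsos : IsSosMod (Ideal.span {cuspCurve}) (affinePoly α a)) : a = 0 ∧ 0 ≤ α := by
  obtain ⟨m, h, hmem⟩ := hsos
  -- apply `ψ`: `α + a₁t² + a₀t³ = ∑ ψ(h_j)²` in `ℝ[t]`
  have hψ : cuspCurveParam (affinePoly α a) = ∑ j, cuspCurveParam (h j) ^ 2 := by
    have h0 := cuspCurveParam_eq_zero_of_mem hmem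
    rw [map_sub, sub_eq_zero, map_sum] at h0
    rw [h0]; simp only [map_pow]
  -- the left-hand side has degree `≤ 3`, so every `ψ(h_j)` has degree `≤ 1` …
  have hdeg : (∑ j, cuspCurveParam (h j) ^ 2).natDegree ≤ 2 * 1 + 1 := by
    rw [← hψ, cuspCurveParam_affinePoly]
    compute_degree!
  have hj1 := natDegree_le_of_natDegree_sum_sq_le _ hdeg
  -- … and no `t¹`-term, hence is a constant `c_j`
  have hjC : ∀ j, ∃ c : ℝ, cuspCurveParam (h j) = Polynomial.C c := fun j =>
    ⟨_, eq_C_of_natDegree_le_one (hj1 j) (coeff_one_cuspCurveParam (h j))⟩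
  choose c hc using hjC
  have hsum : ∑ j, cuspCurveParam (h j) ^ 2 = Polynomial.C (∑ j, c j ^ 2) := by
    rw [map_sum]
    exact Finset.sum_congr rfl fun j _ => by rw [hc j, map_pow]
  -- compare coefficients of `t³`, `t²`, `t⁰` in `α + a₁t² + a₀t³ = ∑ c_j²`
  have e := hψ
  rw [cuspCurveParam_affinePoly, hsum] at e
  have e3 := congrArg (fun q => Polynomial.coeff q 3) e
  have e2 := congrArg (fun q => Polynomial.coeff q 2) e
  have e0 := congrArg (fun q => Polynomial.coeff q 0) e
  simp only [Polynomial.coeff_add, Polynomial.coeff_C_mul, Polynomial.coeff_X_pow,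
    Polynomial.coeff_C, if_true] at e3 e2 e0
  norm_num at e3 e2 e0
  refine ⟨?_, ?_⟩
  · funext i
    fin_cases i
    · exact e3
    · exact e2
  · rw [e0]; exact Finset.sum_nonneg fun j _ => sq_nonneg (c j)

/-- **Example 7.31**: `TH_k(⟨x² - y³⟩) = ℝ²` for every `k` — the theta bodies of the cusp are
"completely ineffective in approximating `conv(V_ℝ(I))`".
[cite: BlekhermanParriloThomas2012, Ch. 7 §7.3.1, Example 7.31, p. 320] -/
theorem thetaBody_cusp_eq_univ (k : ℕ) : thetaBody (Ideal.span {cuspCurve}) k = Set.univ := by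
  refine Set.eq_univ_of_forall fun x α a hl => ?_
  obtain ⟨ha, hα⟩ := eq_zero_of_isSosMod_cusp hl.isSosMod
  rw [ha, zero_dotProduct, add_zero]
  exact hα

/-- On the cusp `y = (x²)^{1/3} ≥ 0`: the real variety lies in the upper half-plane.
[cite: BlekhermanParriloThomas2012, Ch. 7 §7.3.1, Example 7.31, p. 320 ("the closure of the
convex hull of this curve is the upper half-plane")] -/
theorem apply_one_nonneg_of_mem_zeroLocus_cusp {x : Fin 2 → ℝ}
    (hx : x ∈ zeroLocus ℝ (Ideal.span {cuspCurve})) : 0 ≤ x 1 := by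
  rw [zeroLocus_span] at hx
  have h0 : aeval x cuspCurve = 0 := hx cuspCurve (Set.mem_singleton cuspCurve)
  simp only [cuspCurve, map_sub, map_pow, aeval_X, sub_eq_zero] at h0
  have h3 : 0 ≤ x 1 ^ 3 := by rw [← h0]; exact sq_nonneg _
  exact (Odd.pow_nonneg_iff (by decide : Odd 3)).1 h3

/-- Hence `cl(conv(V_ℝ(I))) ⊆ {y ≥ 0}` for the cusp.
[cite: BlekhermanParriloThomas2012, Ch. 7 §7.3.1, Example 7.31, p. 320] -/
theorem closure_convexHull_zeroLocus_cusp_subset :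
    closure (convexHull ℝ (zeroLocus ℝ (Ideal.span {cuspCurve}))) ⊆ {x : Fin 2 → ℝ | 0 ≤ x 1} :=
  closure_minimal
    (convexHull_min (fun _ hx => apply_one_nonneg_of_mem_zeroLocus_cusp hx)
      (convex_halfSpace_ge ⟨fun _ _ => rfl, fun _ _ => rfl⟩ _))
    (isClosed_le continuous_const (continuous_apply 1))

/-- **Example 7.31**: the cusp ideal `⟨x² - y³⟩` is not `TH_k`-exact for any `k`
(`TH_k = ℝ²` contains `(0,-1)`, which is not in `cl(conv(V_ℝ(I))) ⊆ {y ≥ 0}`).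
[cite: BlekhermanParriloThomas2012, Ch. 7 §7.3.1, Example 7.31, p. 320] -/
theorem not_isThetaExact_cusp (k : ℕ) : ¬ IsThetaExact (Ideal.span {cuspCurve}) k := fun hex => by
  have hex' : thetaBody (Ideal.span {cuspCurve}) k =
      closure (convexHull ℝ (zeroLocus ℝ (Ideal.span {cuspCurve}))) := hex
  have hmem : (![0, -1] : Fin 2 → ℝ) ∈ thetaBody (Ideal.span {cuspCurve}) k := by
    rw [thetaBody_cusp_eq_univ]; exact Set.mem_univ _
  rw [hex'] at hmem
  have h := closure_convexHull_zeroLocus_cusp_subset hmem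
  simp only [Set.mem_setOf_eq, Matrix.cons_val_one, Matrix.cons_val_zero] at h
  norm_num at h

/-! ## Example 7.33: the strophoid -/

/-- The strophoid `p(x,y) = (1 - y)x² - (1 + y)y²` (variables `x = X 0`, `y = X 1`).
[cite: BlekhermanParriloThomas2012, Ch. 7 §7.3.1, Example 7.33, p. 321] -/
def strophoid : MvPolynomial (Fin 2) ℝ := (1 - X 1) * X 0 ^ 2 - (1 + X 1) * X 1 ^ 2

/-- Clearing denominators in an sos certificate: an identity `N²·f = ∑_j g_j² + p` with
`p ∈ I`, `N ≠ 0` and `deg g_j ≤ k` shows that `f` is `k`-sos modulo `I` (take `h_j = g_j/N`).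
[folklore] -/
private theorem isKSosMod_of_C_sq_mul_eq {σ : Type*} {I : Ideal (MvPolynomial σ ℝ)} {k m : ℕ}
    {f p : MvPolynomial σ ℝ} (g : Fin m → MvPolynomial σ ℝ) (hdeg : ∀ j, (g j).totalDegree ≤ k)
    {N : ℝ} (hN : N ≠ 0) (hp : p ∈ I) (h : C (N ^ 2) * f = ∑ j, g j ^ 2 + p) :
    IsKSosMod I k f := by
  refine ⟨m, fun j => C N⁻¹ * g j, fun j => (totalDegree_mul _ _).trans
    (by rw [totalDegree_C, zero_add]; exact hdeg j), ?_⟩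
  have hs : ∑ j, g j ^ 2 = C (N ^ 2) * f - p := by rw [h]; ring
  have hNN : C (N⁻¹ ^ 2) * C (N ^ 2) = (1 : MvPolynomial σ ℝ) := by
    rw [← map_mul, inv_pow, inv_mul_cancel₀ (pow_ne_zero 2 hN), map_one]
  have key : f - ∑ j, (C N⁻¹ * g j) ^ 2 = C (N⁻¹ ^ 2) * p := by
    simp_rw [mul_pow, ← map_pow]
    rw [← Finset.mul_sum, hs]
    linear_combination (-f) * hNN
  rw [key]
  exact I.mul_mem_left _ hp

/-- The four squares of the (denominator-cleared) certificate for `1 + y`: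
`4(1 + y) = (2 + y - y²)² + (-y - y²)² + (xy - x)² + (xy - x)² + 2(y - 1)p`, i.e. the book's
`1 + y = (1 + y/2 - y²/2)² + ¼(-y - y²)² + ½(xy - x)² + ½(y - 1)p`.
[cite: BlekhermanParriloThomas2012, Ch. 7 §7.3.1, Example 7.33, p. 321] -/
def strophoidSqPlus : Fin 4 → MvPolynomial (Fin 2) ℝ :=
  ![2 + X 1 - X 1 ^ 2, -X 1 - X 1 ^ 2, X 0 * X 1 - X 0, X 0 * X 1 - X 0]

/-- The four squares of the certificate for `1 - y`:
`4(1 - y) = (2 - y - y²)² + (y - y²)² + (xy - x)² + (xy - x)² + 2(y - 1)p`, i.e. the book's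
`1 - y = (1 - y/2 - y²/2)² + ¼(y - y²)² + ½(xy - x)² + ½(y - 1)p`.
[cite: BlekhermanParriloThomas2012, Ch. 7 §7.3.1, Example 7.33, p. 321] -/
def strophoidSqMinus : Fin 4 → MvPolynomial (Fin 2) ℝ :=
  ![2 - X 1 - X 1 ^ 2, X 1 - X 1 ^ 2, X 0 * X 1 - X 0, X 0 * X 1 - X 0]

/-- The printed identity for `1 + y` (times `4`).
[cite: BlekhermanParriloThomas2012, Ch. 7 §7.3.1, Example 7.33, p. 321] -/
theorem four_mul_one_add_X_one :
    (4 : MvPolynomial (Fin 2) ℝ) * (1 + X 1) =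
      ∑ j, strophoidSqPlus j ^ 2 + 2 * (X 1 - 1) * strophoid := by
  simp only [strophoidSqPlus, Fin.sum_univ_four, Matrix.cons_val_zero, Matrix.cons_val_one,
    Matrix.cons_val_two, Matrix.cons_val_three, Matrix.head_cons, Matrix.tail_cons, strophoid]
  ring

/-- The printed identity for `1 - y` (times `4`).
[cite: BlekhermanParriloThomas2012, Ch. 7 §7.3.1, Example 7.33, p. 321] -/
theorem four_mul_one_sub_X_one :
    (4 : MvPolynomial (Fin 2) ℝ) * (1 - X 1) =
      ∑ j, strophoidSqMinus j ^ 2 + 2 * (X 1 - 1) * strophoid := by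
  simp only [strophoidSqMinus, Fin.sum_univ_four, Matrix.cons_val_zero, Matrix.cons_val_one,
    Matrix.cons_val_two, Matrix.cons_val_three, Matrix.head_cons, Matrix.tail_cons, strophoid]
  ring

/-- The squares in both certificates have degree `≤ 2`. [folklore] -/
private theorem totalDegree_strophoidSq_le (j : Fin 4) :
    (strophoidSqPlus j).totalDegree ≤ 2 ∧ (strophoidSqMinus j).totalDegree ≤ 2 := by
  have hx : ∀ i : Fin 2, (X i : MvPolynomial (Fin 2) ℝ).totalDegree ≤ 1 := fun i => by
    rw [totalDegree_X]
  have hx2 : ∀ i : Fin 2, (X i ^ 2 : MvPolynomial (Fin 2) ℝ).totalDegree ≤ 2 := fun i =>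
    (totalDegree_pow _ _).trans (by rw [totalDegree_X])
  have hxy : (X 0 * X 1 - X 0 : MvPolynomial (Fin 2) ℝ).totalDegree ≤ 2 :=
    (totalDegree_sub _ _).trans (max_le ((totalDegree_mul _ _).trans
      (by rw [totalDegree_X, totalDegree_X])) ((hx 0).trans one_le_two))
  have h2 : (2 : MvPolynomial (Fin 2) ℝ).totalDegree ≤ 2 := by
    rw [show (2 : MvPolynomial (Fin 2) ℝ) = C 2 from (map_ofNat C 2).symm, totalDegree_C]
    exact Nat.zero_le _
  fin_cases j
  · exact ⟨(totalDegree_sub _ _).trans (max_le ((totalDegree_add _ _).trans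
      (max_le h2 ((hx 1).trans one_le_two))) (hx2 1)),
      (totalDegree_sub _ _).trans (max_le ((totalDegree_sub _ _).trans
      (max_le h2 ((hx 1).trans one_le_two))) (hx2 1))⟩
  · exact ⟨(totalDegree_sub _ _).trans (max_le ((totalDegree_neg _).le.trans
      ((hx 1).trans one_le_two)) (hx2 1)),
      (totalDegree_sub _ _).trans (max_le ((hx 1).trans one_le_two) (hx2 1))⟩
  · exact ⟨hxy, hxy⟩
  · exact ⟨hxy, hxy⟩

/-- **Example 7.33**: `1 + y` is `2`-sos modulo the strophoid ideal `⟨p⟩`.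
[cite: BlekhermanParriloThomas2012, Ch. 7 §7.3.1, Example 7.33, p. 321] -/
theorem isKSosMod_two_one_add :
    IsKSosMod (Ideal.span {strophoid}) 2 (1 + X 1 : MvPolynomial (Fin 2) ℝ) :=
  isKSosMod_of_C_sq_mul_eq strophoidSqPlus (fun j => (totalDegree_strophoidSq_le j).1)
    (two_ne_zero) (Ideal.mul_mem_left _ _ (Ideal.subset_span (Set.mem_singleton strophoid)))
    (by rw [← four_mul_one_add_X_one, map_pow, map_ofNat]; norm_num)

/-- **Example 7.33**: `1 - y` is `2`-sos modulo the strophoid ideal `⟨p⟩`.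
[cite: BlekhermanParriloThomas2012, Ch. 7 §7.3.1, Example 7.33, p. 321] -/
theorem isKSosMod_two_one_sub :
    IsKSosMod (Ideal.span {strophoid}) 2 (1 - X 1 : MvPolynomial (Fin 2) ℝ) :=
  isKSosMod_of_C_sq_mul_eq strophoidSqMinus (fun j => (totalDegree_strophoidSq_le j).2)
    (two_ne_zero) (Ideal.mul_mem_left _ _ (Ideal.subset_span (Set.mem_singleton strophoid)))
    (by rw [← four_mul_one_sub_X_one, map_pow, map_ofNat]; norm_num)

/-- `1 + y = affinePoly 1 (0,1)` and `1 - y = affinePoly 1 (0,-1)`. [folklore] -/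
private theorem affinePoly_one_single (s : ℝ) :
    affinePoly 1 (Pi.single 1 s : Fin 2 → ℝ) = (1 + C s * X 1 : MvPolynomial (Fin 2) ℝ) := by
  simp [affinePoly, Fin.sum_univ_two]

/-- **Example 7.33**: `TH_2` of the strophoid ideal lies in the band `B = {-1 ≤ y ≤ 1}`
(the closure of the convex hull of the strophoid); the book shows `TH_2(I) = B`.
[cite: BlekhermanParriloThomas2012, Ch. 7 §7.3.1, Example 7.33, p. 321] -/
theorem thetaBody_two_strophoid_subset_band :
    thetaBody (Ideal.span {strophoid}) 2 ⊆ {x : Fin 2 → ℝ | -1 ≤ x 1 ∧ x 1 ≤ 1} := by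
  intro x hx
  have hp : IsKSosMod (Ideal.span {strophoid}) 2 (affinePoly 1 (Pi.single 1 1 : Fin 2 → ℝ)) := by
    rw [affinePoly_one_single, map_one, one_mul]; exact isKSosMod_two_one_add
  have hm : IsKSosMod (Ideal.span {strophoid}) 2
      (affinePoly 1 (Pi.single 1 (-1) : Fin 2 → ℝ)) := by
    rw [affinePoly_one_single, map_neg, map_one, neg_one_mul, ← sub_eq_add_neg]
    exact isKSosMod_two_one_sub
  have h1 := hx 1 _ hp
  have h2 := hx 1 _ hm
  rw [single_dotProduct, one_mul] at h1
  rw [single_dotProduct, neg_one_mul] at h2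
  exact ⟨by linarith, by linarith⟩

/-- Consequently every `TH_k`, `k ≥ 2`, of the strophoid ideal lies in the band.
[cite: BlekhermanParriloThomas2012, Ch. 7 §7.3.1, Example 7.33, p. 321] -/
theorem thetaBody_strophoid_subset_band {k : ℕ} (hk : 2 ≤ k) :
    thetaBody (Ideal.span {strophoid}) k ⊆ {x : Fin 2 → ℝ | -1 ≤ x 1 ∧ x 1 ≤ 1} :=
  (thetaBody_antitone hk).trans thetaBody_two_strophoid_subset_band

end

end Literature.Algebra.Polynomial.ThetaBodiesCusp
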